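import Summits.AtomisticToContinuum.FouriersLaw.Theses.OddSectorIrreversibility
import Summits.AtomisticToContinuum.FouriersLaw.Theorems.BondHeatUncertaintySubdiffusiveBondHeatKernelGibbsB

/-!
# `OddDensityIsCorrector`, part 4a: energy cutoffs `χ_R = χ(H/R)` and product rules

Helper file for support item `stmt-AtomisticToContinuum-9146`
(`OddSectorIrreversibility.OddDensityIsCorrector`).

The energy estimate proving that `Range(λ - L)|C_c^∞` is dense in `L²(μ_T)` (next file) localises
with the smooth cutoffs `χ_R(x) = χ(H(x)/R)` (`χ = smoothCutoff`: `1` on `(-∞,1]`, `0` on `[2,∞)`),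
which are functions of the ENERGY, hence invisible to the Liouville operator. For the pinned
anharmonic chain (`ω₂ > 0`, `lam, β ≥ 0`) and `R > 0` this file proves: `χ_R ∈ C_c^∞`
(`contDiff_energyCutoff`, `hasCompactSupport_energyCutoff`), `0 ≤ χ_R ≤ 1`, `χ_R → 1` pointwise
(`tendsto_energyCutoff_atTop`), the momentum derivatives `∂_{p_i}χ_R = χ'(H/R) p_i / R` with the
decay `(∂_{p_i}χ_R)² ≤ 4M²/R` (`sq_partialP_energyCutoff_le`, `M = sup|χ'|`, since `p_i² ≤ 2H ≤ 4R`
on the support of `χ'(H/R)`), and `{H, ψ(H)} = 0` termwise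
(`liouville_comp_hamiltonian_eq_zero`); plus the product rules for `partialQ`, `partialP`.
Nothing here closes an item.
-/

noncomputable section

open MeasureTheory Filter Topology Set Function
open scoped ContDiff
open Literature.MathematicalPhysics.KineticTheory.HeatConduction
open Summit.AtomisticToContinuum.FouriersLaw.Theorems.SubdiffusiveBondHeat

namespace Summit.AtomisticToContinuum.FouriersLaw.Theorems.OddSectorIrreversibility

variable {N : ℕ}

/-! ### Product rules for the coordinate derivatives -/

/-- `∂_{q_i}(fg) = f ∂_{q_i}g + g ∂_{q_i}f` for differentiable `f, g`. [folklore] -/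
theorem partialQ_mul {f g : PhaseSpace N → ℝ} (hf : Differentiable ℝ f) (hg : Differentiable ℝ g)
    (i : Fin N) (x : PhaseSpace N) :
    partialQ i (fun y => f y * g y) x = f x * partialQ i g x + g x * partialQ i f x := by
  have hfg : Differentiable ℝ (fun y => f y * g y) := hf.mul hg
  rw [partialQ_eq_fderiv hfg, partialQ_eq_fderiv hf, partialQ_eq_fderiv hg]
  simp only
  rw [fderiv_fun_mul (hf x) (hg x)]
  simp only [add_apply, smul_apply, smul_eq_mul]

/-- `∂_{p_i}(fg) = f ∂_{p_i}g + g ∂_{p_i}f` for differentiable `f, g`. [folklore] -/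
theorem partialP_mul {f g : PhaseSpace N → ℝ} (hf : Differentiable ℝ f) (hg : Differentiable ℝ g)
    (i : Fin N) (x : PhaseSpace N) :
    partialP i (fun y => f y * g y) x = f x * partialP i g x + g x * partialP i f x := by
  have hfg : Differentiable ℝ (fun y => f y * g y) := hf.mul hg
  rw [partialP_eq_fderiv hfg, partialP_eq_fderiv hf, partialP_eq_fderiv hg]
  simp only
  rw [fderiv_fun_mul (hf x) (hg x)]
  simp only [add_apply, smul_apply, smul_eq_mul]

/-! ### Functions of the energy -/

/-- **`{H, ψ(H)} = 0`, termwise**: `p_i ∂_{q_i} ψ(H) - ∂_{q_i}H ∂_{p_i} ψ(H) = 0` for every site `i`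
(chain rule: both terms are `ψ'(H) p_i ∂_{q_i}H`). [folklore] -/
theorem liouville_comp_hamiltonian_eq_zero (P : OscillatorChain) (hH : Differentiable ℝ (P.hamiltonian N))
    {ψ ψ' : ℝ → ℝ} (hψ : ∀ u, HasDerivAt ψ (ψ' u) u) (i : Fin N) (x : PhaseSpace N) :
    x.2 i * partialQ i (fun y => ψ (P.hamiltonian N y)) x -
      partialQ i (P.hamiltonian N) x * partialP i (fun y => ψ (P.hamiltonian N y)) x = 0 := by
  rw [P.partialQ_comp_hamiltonian hH hψ x i, P.partialP_comp_hamiltonian hψ N i]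
  ring

/-! ### The energy cutoffs of the pinned chain -/

section Pinned

variable {ω₂ lam β γ : ℝ} (hω : 0 < ω₂) (hl : 0 ≤ lam) (hβ : 0 ≤ β)

/-- `u ↦ χ(u/R)` and its derivative `χ'(u/R)/R`. [folklore] -/
theorem hasDerivAt_smoothCutoff_div (R u : ℝ) :
    HasDerivAt (fun v => smoothCutoff (v / R)) (deriv smoothCutoff (u / R) / R) u := by
  have h := (hasDerivAt_smoothCutoff (u / R)).comp u ((hasDerivAt_id u).div_const R)
  simpa [Function.comp_def, div_eq_mul_inv, mul_comm] using h

/-- The energy cutoff `χ_R = χ(H/R)` is smooth. [folklore] -/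
theorem contDiff_energyCutoff (γ' : ℝ) (N : ℕ) (R : ℝ) :
    ContDiff ℝ ∞ (fun x : PhaseSpace N => smoothCutoff ((pinnedChain ω₂ lam β γ').hamiltonian N x / R)) :=
  contDiff_smoothCutoff.comp (((pinnedChain ω₂ lam β γ').contDiff_hamiltonian
    (pinnedChain_contDiff_U ω₂ lam β γ') (pinnedChain_contDiff_V ω₂ lam β γ') N).div_const R)

/-- `0 ≤ χ_R ≤ 1`. [folklore] -/
theorem energyCutoff_mem_Icc (P : OscillatorChain) (N : ℕ) (R : ℝ) (x : PhaseSpace N) :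
    smoothCutoff (P.hamiltonian N x / R) ∈ Icc (0 : ℝ) 1 :=
  ⟨smoothCutoff_nonneg _, smoothCutoff_le_one _⟩

include hω hl hβ in
/-- The energy cutoff is compactly supported: `supp χ_R ⊆ {H ≤ 2R}`, a compact set for the pinned
chain (`R > 0`). [folklore] -/
theorem hasCompactSupport_energyCutoff (γ' : ℝ) (N : ℕ) {R : ℝ} (hR : 0 < R) :
    HasCompactSupport (fun x : PhaseSpace N => smoothCutoff ((pinnedChain ω₂ lam β γ').hamiltonian N x / R)) := by
  refine HasCompactSupport.intro (pinnedChain_isCompact_setOf_hamiltonian_le hω hl hβ γ' N (2 * R)) ?_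
  intro x hx
  simp only [mem_setOf_eq, not_le] at hx
  exact smoothCutoff_of_two_le ((le_div_iff₀ hR).2 (by linarith))

/-- `χ_R(x) → 1` as `R → ∞`, for every `x` (indeed `χ_R(x) = 1` once `R ≥ H(x)`). [folklore] -/
theorem tendsto_energyCutoff_atTop (P : OscillatorChain) (N : ℕ) (x : PhaseSpace N) :
    Tendsto (fun R : ℝ => smoothCutoff (P.hamiltonian N x / R)) atTop (𝓝 1) := by
  refine tendsto_const_nhds.congr' ?_
  filter_upwards [eventually_ge_atTop (max (P.hamiltonian N x) 1)] with R hR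
  have hR1 : 0 < R := lt_of_lt_of_le one_pos ((le_max_right _ _).trans hR)
  have hH : P.hamiltonian N x ≤ R := (le_max_left _ _).trans hR
  exact (smoothCutoff_of_le_one ((div_le_one hR1).2 hH)).symm

/-- `∂_{p_i} χ_R = χ'(H/R) p_i / R`. [folklore] -/
theorem partialP_energyCutoff (P : OscillatorChain) (N : ℕ) (R : ℝ) (i : Fin N) (x : PhaseSpace N) :
    partialP i (fun y : PhaseSpace N => smoothCutoff (P.hamiltonian N y / R)) x =
      deriv smoothCutoff (P.hamiltonian N x / R) / R * x.2 i := by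
  rw [P.partialP_comp_hamiltonian (fun u => hasDerivAt_smoothCutoff_div R u) N i]

include hl hβ in
/-- **Decay of the momentum derivatives of the cutoff**: with `M = sup |χ'|`,
`(∂_{p_i} χ_R)² ≤ 4M²/R` for `R > 0` — on the support of `χ'(H/R)` one has `H ≤ 2R`, hence
`p_i² ≤ 2H ≤ 4R`, and `∂_{p_i}χ_R = χ'(H/R) p_i/R`. [folklore] -/
theorem sq_partialP_energyCutoff_le (hω' : 0 ≤ ω₂) (γ' : ℝ) (N : ℕ) {R : ℝ} (hR : 0 < R) {M : ℝ}
    (hM : ∀ u, |deriv smoothCutoff u| ≤ M) (i : Fin N) (x : PhaseSpace N) :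
    (partialP i (fun y : PhaseSpace N => smoothCutoff ((pinnedChain ω₂ lam β γ').hamiltonian N y / R)) x) ^ 2 ≤
      4 * M ^ 2 / R := by
  set Hx := (pinnedChain ω₂ lam β γ').hamiltonian N x with hHx
  rw [partialP_energyCutoff]
  by_cases hle : Hx ≤ 2 * R
  · -- `p_i² ≤ 2H ≤ 4R`
    have hsum := pinnedChain_harmonic_le_hamiltonian (ω₂ := ω₂) hl hβ γ' N x
    have h1 : 0 ≤ ∑ j, ω₂ * x.1 j ^ 2 / 2 := Finset.sum_nonneg fun j _ => by positivity
    have h2 : x.2 i ^ 2 / 2 ≤ ∑ j, x.2 j ^ 2 / 2 :=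
      Finset.single_le_sum (f := fun j => x.2 j ^ 2 / 2) (fun j _ => by positivity) (Finset.mem_univ _)
    have hp : x.2 i ^ 2 ≤ 4 * R := by linarith
    have hd : (deriv smoothCutoff (Hx / R)) ^ 2 ≤ M ^ 2 := by
      have := hM (Hx / R)
      rw [← sq_abs]
      exact pow_le_pow_left₀ (abs_nonneg _) this 2
    calc (deriv smoothCutoff (Hx / R) / R * x.2 i) ^ 2
        = (deriv smoothCutoff (Hx / R)) ^ 2 * x.2 i ^ 2 / R ^ 2 := by field_simp
      _ ≤ M ^ 2 * (4 * R) / R ^ 2 := by gcongr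
      _ = 4 * M ^ 2 / R := by field_simp
  · have hgt : 2 < Hx / R := by rw [lt_div_iff₀ hR]; linarith
    have h0 : deriv smoothCutoff (Hx / R) = 0 :=
      deriv_smoothCutoff_eq_zero_of_notMem fun h => absurd h.2 (not_le.2 hgt)
    rw [h0]
    simp only [zero_div, zero_mul, ne_eq, OfNat.ofNat_ne_zero, not_false_eq_true, zero_pow]
    positivity

end Pinned

end Summit.AtomisticToContinuum.FouriersLaw.Theorems.OddSectorIrreversibility

end
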